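import Summits.AtomisticToContinuum.HydrodynamicLimit.Theorems.OneFlightGossipEngineCollisionActivityTailsActivityDomination
import Summits.AtomisticToContinuum.HydrodynamicLimit.Theorems.OneFlightGossipEngineCollisionActivityTailsOneWindow

/-!
# Ideator-six sketch (crux-ideate round 2, k = 6) for `CollisionActivityTails` (stmt-AtomisticToContinuum-13734)

First lemmas of the two idea cards (+ one recorded device), typed over LANDED vocabulary
(`Theorems/OneFlightGossipEngineCollisionActivityTails{ActivityDomination,OneWindow}.lean`).
Nothing here is a line skeleton; no `sorry`; only `Prop` definitions and two trivial proofs.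

* Card `threshold-freedom-rare-targets`: `hotCrowdedKinetic`, `nearFieldKinetic_le_hotCrowded` (pathwise re-cut,
  PROVED), `TailRecut` (the tail-algebra consequence, provable now), `PairwiseActivityCap` (kinematic, M-sized).
* Card `tilt-invisible-unstable-leaves`: `localGibbsWeight_reflectVel` (collision invariance of the local-Gibbs pair
  weight — the s = 0 mechanism, PROVED from momentum/energy conservation of `reflectVel`), `TiltInvisibilityKernel`
  (abstract change-of-measure kernel: a tilt measurable w.r.t. the leaf σ-algebra does not change conditional
  expectations given the leaves).
* Device `dlr-fresh-influence-cone` (NOTES.md, not filed as a card): `PairCollideOnce` (two free hard spheres meet at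
  most once — also the kinematic kernel of card 1's `PairwiseActivityCap`).
-/

namespace Summit.AtomisticToContinuum.HydrodynamicLimit.Cruxes.CollisionActivityTails.IdeatorSix

open MeasureTheory Set
open Literature.MathematicalPhysics.KineticTheory Literature.Analysis.FluidPDE
open Summit.AtomisticToContinuum.HydrodynamicLimit.Theorems.CollisionActivityTailsActivityDomination
open Summit.AtomisticToContinuum.HydrodynamicLimit.Theorems.CollisionActivityTailsWindowAlgebra
open Summit.AtomisticToContinuum.HydrodynamicLimit.Theorems.CollisionActivityTailsNearFieldKineticTails (tailFn)

noncomputable section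

/-! ## Card 1 — threshold freedom: the hot-or-crowded re-cut of `F²` -/

/-- The HOT-OR-CROWDED part of the near-field relative kinetic energy: the window average of `relKineticNear` restricted
to the instants at which either `≥ 3` centres crowd the `2ε`-ball of `i` or the near-field relative kinetic energy itself
exceeds `4 (u σ)²` (`u σ` = a speed-truncation level, chosen after `σ`, absorbed by the crux's existential `V₀`). -/
def hotCrowdedKinetic (u : ℝ → ℝ) : WindowFunctional := fun {σ N} Φ τ s i z =>
  (window τ N)⁻¹ * ∫ t in s..(s + window τ N),
    (if 3 ≤ nearCount (Φ.flow t z) i (2 * hsDiameter σ N) ∨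
          4 * (u σ) ^ 2 < relKineticNear (Φ.flow t z) i (2 * hsDiameter σ N) then
        relKineticNear (Φ.flow t z) i (2 * hsDiameter σ N) else 0)

/-- The instantaneous re-cut is trivial: outside hot-or-crowded instants the near-field relative kinetic energy is
`≤ 4 (u σ)²` BY DEFINITION of the indicator (no speed hypothesis). -/
theorem relKineticNear_le_recut (u : ℝ → ℝ) {σ : ℝ} {N : ℕ} (y : Cfg N) (i : Fin (N + 1)) :
    relKineticNear y i (2 * hsDiameter σ N) ≤ 4 * (u σ) ^ 2 +
      (if 3 ≤ nearCount y i (2 * hsDiameter σ N) ∨ 4 * (u σ) ^ 2 < relKineticNear y i (2 * hsDiameter σ N) then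
        relKineticNear y i (2 * hsDiameter σ N) else 0) := by
  have h0 : 0 ≤ relKineticNear y i (2 * hsDiameter σ N) := by
    unfold relKineticNear
    exact Finset.sum_nonneg fun j _ => by split_ifs <;> positivity
  split_ifs with h
  · nlinarith [sq_nonneg (u σ)]
  · push Not at h
    linarith [h.2, sq_nonneg (u σ)]

/-- **TAIL RE-CUT** (provable now, S-sized: `relKineticNear_le_recut` integrated over the window on good orbits, then
`tailFn V (4u² + H) ≤ 2 · tailFn (V/2) H` for `V ≥ 8u²`, measurability from the landed near-field measurability files):
for EVERY truncation profile `u`, crux-shaped tails of the hot-or-crowded part give crux-shaped tails of `F²`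
(`B′ = NearFieldKineticTails` of the dead line), with `V₀ ↦ max (2 V₀) (8 (u σ)²)`.  Composed with the landed reduction
`TailStatement F² → TailStatement Fcr → CollisionActivityTails` (p119730) the crux is
`TailStatement (hotCrowdedKinetic u) ∧ TailStatement Fcr` for any `u`. -/
def TailRecut : Prop :=
  ∀ u : ℝ → ℝ, TailStatement (hotCrowdedKinetic u) →
    TailStatement (fun {σ N} (Φ : Flow σ N) τ s i z => nearFieldKinetic Φ τ s i z)

/-- **PAIRWISE ACTIVITY CAP** (kinematic, M-sized; card 1's second statement).  If throughout the closed window at most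
ONE other centre is within `4ε` of `x_i` and every centre within `4ε` (including `i`) has speed `≤ u`, then `i`'s window
activity is `≤ 2u² + 4uσ/τ`: two free spheres collide at most once, a second `i–j` collision needs a third centre within
`4ε` (excluded), so collisions of `i` are single passes, each needing an exclusive approach time `≥ ε/u`, i.e.
`#collisions ≤ 2 + u w/ε = 2 + u τ/σ`, impulse `≤ 2u` each (`impulse_ofConfig_le_add`). -/
def PairwiseActivityCap : Prop :=
  ∀ (σ : ℝ), 0 < σ → σ ≤ 1 / 8 → ∀ (N : ℕ) (Φ : Flow σ N) (τ : ℝ), 0 < τ → ∀ (s u : ℝ), 0 ≤ u →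
    ∀ z ∈ Φ.good, ∀ i : Fin (N + 1),
      (∀ t ∈ Set.Icc s (s + window τ N), nearCount (Φ.flow t z) i (4 * hsDiameter σ N) ≤ 2) →
      (∀ t ∈ Set.Icc s (s + window τ N), ∀ j : Fin (N + 1),
          tdist (Φ.flow t z j).1 (Φ.flow t z i).1 ≤ 4 * hsDiameter σ N → ‖(Φ.flow t z j).2‖ ≤ u) →
      act Φ τ s i z ≤ 2 * u ^ 2 + 4 * u * σ / τ

/-! ## Card 2 — tilt invisibility on unstable leaves -/

/-- **Collision invariance of the local-Gibbs pair weight** (the `s = 0` mechanism, PROVED): the hard-sphere collision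
law `reflectVel n` conserves `‖v₁ - u‖² + ‖v₂ - u‖²` for every drift `u` and every impact direction `n`, so the local
Gibbs weight `exp(-(‖v₁-u₀(x)‖² + ‖v₂-u₀(x)‖²)/(2θ₀(x)))` of a colliding pair at a common macroscopic point is constant
along the one-collision plaque (vary `n`).  The tilt `dλ₀/dG` varies along plaques only through macroscopic position
offsets and, for `s > 0`, through the divergent DEEP past of plaque points — absent on true unstable leaves. -/
theorem localGibbsWeight_reflectVel (u n : V3) (p : V3 × V3) :
    ‖(reflectVel n p).1 - u‖ ^ 2 + ‖(reflectVel n p).2 - u‖ ^ 2 = ‖p.1 - u‖ ^ 2 + ‖p.2 - u‖ ^ 2 := by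
  simp only [reflectVel]
  set c : ℝ := inner ℝ (p.1 - p.2) n / ‖n‖ ^ 2 with hc
  have h1 : p.1 - c • n - u = (p.1 - u) - c • n := by abel
  have h2 : p.2 + c • n - u = (p.2 - u) + c • n := by abel
  rw [h1, h2, @norm_sub_sq_real, @norm_add_sq_real]
  have key : inner ℝ (p.1 - u) (c • n) - inner ℝ (p.2 - u) (c • n) = ‖c • n‖ ^ 2 := by
    rw [← inner_sub_left, show p.1 - u - (p.2 - u) = p.1 - p.2 by abel, inner_smul_right, norm_smul,
      mul_pow, Real.norm_eq_abs, sq_abs]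
    by_cases hn : n = 0
    · simp [hn]
    · have hn' : ‖n‖ ^ 2 ≠ 0 := pow_ne_zero 2 (norm_ne_zero_iff.2 hn)
      have hcn : inner ℝ (p.1 - p.2) n = c * ‖n‖ ^ 2 := by rw [hc, div_mul_cancel₀ _ hn']
      rw [hcn]
      ring
  linarith

/-- **TILT-INVISIBILITY KERNEL** (abstract change of measure; provable now from the Bayes formula for conditional
expectations): if `μ = F · ν` with a tilt `F` that is measurable w.r.t. a sub-σ-algebra `m` (read: `m` = the σ-algebra
of local unstable leaves, `F = dλ_s/dG` constant on leaves), then conditional expectations given `m` under `μ` and under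
`ν` agree `μ`-a.e.  The card's dynamical input is that `dλ_s/dG = F₀ ∘ Φ_{-s}` IS (up to a factor `e^{±η}`, `η → 0`)
leaf-measurable, by backward contraction of local unstable manifolds and the macroscopic Lipschitz bound on `log F₀`. -/
def TiltInvisibilityKernel : Prop :=
  ∀ (Ω : Type) [m0 : MeasurableSpace Ω] (m : MeasurableSpace Ω), m ≤ m0 →
    ∀ (ν : Measure Ω) [IsFiniteMeasure ν] (F : Ω → NNReal), Measurable[m] F →
      ∀ f : Ω → ℝ, Integrable f ν → Integrable f (ν.withDensity fun ω => (F ω : ENNReal)) →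
        MeasureTheory.condExp m (ν.withDensity fun ω => (F ω : ENNReal)) f
          =ᵐ[ν.withDensity fun ω => (F ω : ENNReal)] MeasureTheory.condExp m ν f

/-! ## Device — two free spheres meet once (kernel of `PairwiseActivityCap`) -/

/-- **Two free hard spheres meet at most once** (kinematic half of "a fresh partner is a single pass"): along two
free flights in `ℝ³` the squared distance is a convex quadratic in time, so the contact level `ε²` is hit from above at
most once while approaching. Typed on `V3 = ℝ³` data (positions `x y`, velocities `v w`). -/
def PairCollideOnce : Prop :=
  ∀ (ε : ℝ), 0 < ε → ∀ (x y v w : V3), ∀ t₁ t₂ : ℝ, t₁ < t₂ →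
    ‖(x + t₁ • v) - (y + t₁ • w)‖ = ε → inner ℝ ((x + t₁ • v) - (y + t₁ • w)) (v - w) < 0 →
    ‖(x + t₂ • v) - (y + t₂ • w)‖ = ε → ¬ inner ℝ ((x + t₂ • v) - (y + t₂ • w)) (v - w) < 0

end

end Summit.AtomisticToContinuum.HydrodynamicLimit.Cruxes.CollisionActivityTails.IdeatorSix
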